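import Summits.AtomisticToContinuum.HydrodynamicLimit.Theorems.OneFlightGossipEngineCollisionActivityTailsEquilibriumRung
import HarnessLib

/-!
# Strategist sketch (cstrat-stmt-AtomisticToContinuum-13734-s1, 2026-08-17) — typed statements quoted in STRATEGY-CENSUS.md

Nothing here is registered or claimed; the file only certifies that the statements the census talks about ELABORATE over
existing declarations (lean check rc 0, no sorry outside nothing — there is no sorry).

* `CollisionActivityTailsGuarded` — the GUARD-RELATIVISED crux CAT_η (packing guard `ρ_t(x) σ³ < η₀` on the classical solution,
  `∃ η₀` outermost, exactly the shape of the re-typed conjunct `_root_.HydrodynamicLimit`, D-0032); `guarded_of_collisionActivityTails`: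
  it is a WEAKENING of the crux (so a tenure `--restate` is a 1:1 weakening the dock can consume along guarded solutions).
* `PreShockEnvelopeDiluteGuarded` — the NAIVE guard-relativisation of the live line's import 4' (global Gaussian constants + the
  dilute clause); recorded because the census argues it is STILL mis-typed (temperature/Mach contrast of the profiles is fixed after `η₀`).
* `PreShockLocalEnvelope` — the LOCAL Maxwellian envelope along the Euler solution (absolute `A`, `λ`; large `N` only), the
  N2 import a localised line would consume; guard-compatible by construction (diluteness = `A ρ σ³ < A η₀`).
* `equilibrium_sanity` — the shape of its equilibrium instance against the landed BGSR bound is NOT proved here (pointer only).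
-/

noncomputable section

open MeasureTheory Set Filter Topology
open scoped ENNReal

namespace Summit.AtomisticToContinuum.HydrodynamicLimit.Cruxes.CollisionActivityTails.Strategist

open Literature.MathematicalPhysics.KineticTheory Literature.Analysis.FluidPDE
open Summit.AtomisticToContinuum.HydrodynamicLimit.Theorems.CollisionActivityTailsActivityDomination (Flow Cfg window act)
open Summit.AtomisticToContinuum.HydrodynamicLimit.Theorems.CollisionActivityTailsNearFieldKineticTails (tailFn)
open Summit.AtomisticToContinuum.HydrodynamicLimit.Theorems.CollisionActivityTailsPlaqueSplit (EnvelopeOn)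

/-- **CAT_η — the guard-relativised crux.** Verbatim `CollisionActivityTails` with the conjunct's packing guard
`∀ t' ∈ [0,T), ∀ x, ρ t' x · σ³ < η₀` inserted as a hypothesis on the classical solution and `∃ η₀ > 0` outermost
(the shape of the re-typed `_root_.HydrodynamicLimit`). -/
def CollisionActivityTailsGuarded : Prop :=
  ∃ η₀ : ℝ, 0 < η₀ ∧
  ∀ (a₀ θ₀ : T3 → ℝ) (u₀ : T3 → V3), Continuous a₀ → Continuous θ₀ → Continuous u₀ →
    (∀ x, 0 < a₀ x) → (∀ x, 0 < θ₀ x) → ∃ σ₀ : ℝ, 0 < σ₀ ∧ ∀ σ : ℝ, 0 < σ → σ < σ₀ →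
    ∀ (T : ℝ) (ρ θ : ℝ → T3 → ℝ) (u : ℝ → T3 → V3), IsHardSphereEulerSolution σ T ρ u θ →
    (∀ t' ∈ Set.Ico 0 T, ∀ x, ρ t' x * σ ^ 3 < η₀) →
    ∀ Φ : (N : ℕ) → Flow σ N,
    TendstoHydroFieldsAt (fun N => localGibbsLaw σ a₀ u₀ θ₀ N (Φ N)) Φ ρ u θ 0 →
    ∀ t ∈ Set.Ico 0 T, ∃ V₀ : ℝ, 0 < V₀ ∧ ∀ V : ℝ, V₀ ≤ V → ∀ ε : ℝ, 0 < ε →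
    ∃ τ₀ : ℝ, 0 < τ₀ ∧ ∀ τ : ℝ, τ₀ ≤ τ → ∃ N₀ : ℕ, ∀ N : ℕ, N₀ ≤ N → ∀ s ∈ Set.Icc 0 t,
      ∫⁻ z, ENNReal.ofReal (((N : ℝ) + 1)⁻¹ * ∑ i : Fin (N + 1), tailFn V (act (Φ N) τ s i z))
        ∂(localGibbsLaw σ a₀ u₀ θ₀ N (Φ N)) ≤ ENNReal.ofReal ε

/-- CAT_η is a weakening of the crux (ignore the guard; `η₀ := 1`). -/
theorem guarded_of_collisionActivityTails
    (h : Summit.AtomisticToContinuum.HydrodynamicLimit.Theses.OneFlightGossipEngine.CollisionActivityTails) :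
    CollisionActivityTailsGuarded := by
  refine ⟨1, one_pos, fun a₀ θ₀ u₀ ha hθ hu ha0 hθ0 => ?_⟩
  obtain ⟨σ₀, hσ₀, h⟩ := h a₀ θ₀ u₀ ha hθ hu ha0 hθ0
  refine ⟨σ₀, hσ₀, fun σ hσ hσlt T ρ θ u hsol _ Φ hLLN t ht => ?_⟩
  exact h σ hσ hσlt T ρ θ u hsol Φ hLLN t ht

/-- **The NAIVE guard-relativisation of 4'** (global Gaussian constants, dilute clause, guard hypothesis, `∀ κ ∃ η₀` before the
profiles). Recorded for the census, which argues it is still false-in-a-corner: with ONE global Gaussian the constant `C (2π/β)^{3/2}`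
carries the temperature / Mach contrast of the solution, fixed only after `η₀`. -/
def PreShockEnvelopeDiluteGuarded : Prop :=
  ∀ κ : ℝ, 0 < κ → ∃ η₀ : ℝ, 0 < η₀ ∧
  ∀ (a₀ θ₀ : T3 → ℝ) (u₀ : T3 → V3), Continuous a₀ → Continuous θ₀ → Continuous u₀ →
    (∀ x, 0 < a₀ x) → (∀ x, 0 < θ₀ x) → ∃ σ₀ : ℝ, 0 < σ₀ ∧ ∀ σ : ℝ, 0 < σ → σ < σ₀ →
    ∀ (T : ℝ) (ρ θ : ℝ → T3 → ℝ) (u : ℝ → T3 → V3), IsHardSphereEulerSolution σ T ρ u θ →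
    (∀ t' ∈ Set.Ico 0 T, ∀ x, ρ t' x * σ ^ 3 < η₀) →
    ∀ Φ : (N : ℕ) → Flow σ N,
    TendstoHydroFieldsAt (fun N => localGibbsLaw σ a₀ u₀ θ₀ N (Φ N)) Φ ρ u θ 0 →
    ∀ t ∈ Set.Ico 0 T, ∃ β C : ℝ, 0 < β ∧ 0 ≤ C ∧ C * (2 * Real.pi / β) ^ (3 / 2 : ℝ) * σ ^ 3 * max 1 β⁻¹ ≤ κ ∧
      EnvelopeOn σ a₀ θ₀ u₀ Φ t β C

/-- **PRE-SHOCK LOCAL MAXWELLIAN ENVELOPE** (the N2 import of a LOCALISED line; LanfordEnvelopeLoc-kind, cf. the BGEndpointRigidity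
consumer note on 13677). There are ABSOLUTE constants `A`, `λ` and an absolute packing range `η₁` such that, in the crux's pre-shock frame
restricted to solutions obeying the packing guard `ρ σ³ < η₁` (the dense corner, where contact correlations exceed any absolute `A²`, is
excluded by hypothesis exactly as in the re-typed conjunct), for every `t < T` and all LARGE `N`, every bounded-order volume-marginal of the true law at time `r ≤ t` is a.e. bounded by
`A^k ∏_i ρ(r, x_i) · M_{1, u(r,x_i), λ θ(r,x_i)}(v_i)` — the Euler solution itself is the envelope. No constants clause: under the
conjunct's guard `ρ σ³ < η₀` the envelope is dilute wherever it needs to be (`A ρ σ³ < A η₀`), whatever the contrast of the profiles.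
Large `N` only (`∃ N₀` after `t`): small systems do not follow the Euler solution. Equilibrium / `t = 0` instances are of the kind of
the landed BGSR bound `nthMarginal_canonicalDensity_le_two_pow` (`A = 2 λ^{3/2}`). Conjecture-grade: an `L^∞` propagation of local
equilibrium for all marginals, beyond Lanford's time at fixed density. -/
def PreShockLocalEnvelope : Prop :=
  ∃ A lam η₁ : ℝ, 0 < A ∧ 1 < lam ∧ 0 < η₁ ∧
  ∀ (a₀ θ₀ : T3 → ℝ) (u₀ : T3 → V3), Continuous a₀ → Continuous θ₀ → Continuous u₀ →
    (∀ x, 0 < a₀ x) → (∀ x, 0 < θ₀ x) → ∃ σ₀ : ℝ, 0 < σ₀ ∧ ∀ σ : ℝ, 0 < σ → σ < σ₀ →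
    ∀ (T : ℝ) (ρ θ : ℝ → T3 → ℝ) (u : ℝ → T3 → V3), IsHardSphereEulerSolution σ T ρ u θ →
    (∀ t' ∈ Set.Ico 0 T, ∀ x, ρ t' x * σ ^ 3 < η₁) →
    ∀ Φ : (N : ℕ) → Flow σ N,
    TendstoHydroFieldsAt (fun N => localGibbsLaw σ a₀ u₀ θ₀ N (Φ N)) Φ ρ u θ 0 →
    ∀ t ∈ Set.Ico 0 T, ∃ N₀ : ℕ, ∀ N : ℕ, N₀ ≤ N → ∀ k : ℕ, ∀ r ∈ Set.Icc 0 t,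
      ∀ᵐ Zk : Config k (Fin 3) T3,
        |nthMarginal (N + 1) k ((hardSphereDomain (Torus.geometry (Fin 3)) (N + 1) (hsDiameter σ N)).indicator
            (hsTransport (Φ N) r (canonicalDensity (Torus.geometry (Fin 3)) (hsDiameter σ N) (N + 1)
              (localGibbsProfile a₀ u₀ θ₀)))) Zk| ≤
          A ^ k * ∏ i : Fin k, ρ r (Zk i).1 * localMaxwellian 1 (lam * θ r (Zk i).1) (u r (Zk i).1) (Zk i).2

end Summit.AtomisticToContinuum.HydrodynamicLimit.Cruxes.CollisionActivityTails.Strategist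

end
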